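import Mathlib

/-!
# The bouquet determinant

Wall-breaker axis D (det-orbit-closure multiplicity bounds) for crux `ValuativeGCT.ValuativeFlip`
(stmt-ValiantsHypothesis-12624): the matrix identity behind the BOUQUET TEST FORMS of `Det_m`.

A *bouquet* is a directed graph made of a hub and finitely many *petals* `d : ι`; petal `d` is a
directed cycle through the hub with `ℓ d` further ("internal") vertices `⟨d, 0⟩, …, ⟨d, ℓ d - 1⟩`
(for `ℓ d = 0` the petal is a loop at the hub).  Label the edge out of the hub into petal `d` by
`first d` and the edge out of the internal vertex `⟨d, i⟩` by `mid d i`, put `1` on the diagonal and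
allow `pad` further isolated vertices.  Since two distinct petals share the hub, the only permutations
supported on the bouquet are the identity and the single petal cycles, so the determinant of the
resulting unipotent-bordered matrix has NO cross terms:

  `det M = 1 + ∑ d, (-1) ^ ℓ d * (first d * ∏ i, mid d i)`.

We prove this (`bq_det_eq`) by expanding around the unitriangular block of internal vertices
(`Matrix.det_fromBlocks₁₁`), whose inverse applied to the hub column is computed by back-substitution
(`bq_mulVec_z`).  Used in `…BouquetTestForms` to realise `X_{i₀}^m + ∑_j t_j X_{i₀}^{m-|γ_j|} x^{γ_j}` as
an `m × m` determinant of linear forms with `m = 1 + ∑_j (|γ_j| - 1)`, the engine of the factor-sensitive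
no-equation criterion for `Det_m`.  Pure matrix algebra over a commutative ring; no definitions.
[folklore: determinant of a digraph with a unique cycle structure (Harary 1962, "The determinant of the
adjacency matrix of a graph", SIAM Rev. 4); the bordered/Schur-complement route is standard]
-/

set_option linter.dupNamespace false

namespace Summit.ValiantsHypothesis.ValiantsHypothesis.Theorems.ValuativeFlip

open Matrix
open scoped BigOperators

noncomputable section

variable {S : Type*} [CommRing S] {ι : Type*} [Fintype ι] [DecidableEq ι]

/-- Splitting off the first factor of a product over a final segment of `Fin n`. [folklore] -/
theorem bq_prod_filter_le_succ {n : ℕ} (f : Fin n → S) (i : Fin n) :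
    ∏ t ∈ Finset.univ.filter (fun t : Fin n => (i : ℕ) ≤ t), f t =
      f i * ∏ t ∈ Finset.univ.filter (fun t : Fin n => (i : ℕ) + 1 ≤ t), f t := by
  classical
  have hi : i ∈ Finset.univ.filter (fun t : Fin n => (i : ℕ) ≤ t) := by simp
  rw [← Finset.mul_prod_erase _ _ hi]
  congr 1
  refine Finset.prod_congr ?_ fun _ _ => rfl
  ext t
  simp only [Finset.mem_erase, Finset.mem_filter, Finset.mem_univ, true_and]
  constructor
  · rintro ⟨h1, h2⟩
    have : (t : ℕ) ≠ i := fun h => h1 (Fin.ext h)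
    omega
  · intro h
    refine ⟨fun h' => ?_, by omega⟩
    rw [h'] at h
    omega

/-- **Back-substitution in a bouquet.**  For the unitriangular block `D` of internal vertices of a
bouquet (`D ⟨d,i⟩ ⟨d,i⟩ = 1`, `D ⟨d,i⟩ ⟨d,i+1⟩ = mid d i`, all other entries `0`, padding vertices
isolated) and the hub column `b ⟨d, ℓ d - 1⟩ = mid d (ℓ d - 1)` (else `0`), the vector
`z ⟨d, i⟩ = (-1)^(ℓ d - 1 - i) ∏_{t ≥ i} mid d t` solves `D z = b`. [folklore] -/
theorem bq_mulVec_z (ℓ : ι → ℕ) (pad : ℕ) (mid : (d : ι) → Fin (ℓ d) → S)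
    (D : Matrix ((Σ d : ι, Fin (ℓ d)) ⊕ Fin pad) ((Σ d : ι, Fin (ℓ d)) ⊕ Fin pad) S)
    (h_pp : ∀ (d : ι) (i : Fin (ℓ d)) (d' : ι) (i' : Fin (ℓ d')),
      D (Sum.inl ⟨d, i⟩) (Sum.inl ⟨d', i'⟩) =
        if d = d' ∧ (i' : ℕ) = i then 1 else if d = d' ∧ (i' : ℕ) = i + 1 then mid d i else 0)
    (h_pq : ∀ (d : ι) (i : Fin (ℓ d)) (p : Fin pad), D (Sum.inl ⟨d, i⟩) (Sum.inr p) = 0)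
    (h_qp : ∀ (p : Fin pad) (d : ι) (i : Fin (ℓ d)), D (Sum.inr p) (Sum.inl ⟨d, i⟩) = 0) :
    D *ᵥ (Sum.elim (fun v : (Σ d : ι, Fin (ℓ d)) => (-1 : S) ^ (ℓ v.1 - 1 - (v.2 : ℕ)) *
        ∏ t ∈ Finset.univ.filter (fun t : Fin (ℓ v.1) => (v.2 : ℕ) ≤ t), mid v.1 t) (fun _ => 0)) =
      Sum.elim (fun v : (Σ d : ι, Fin (ℓ d)) => if (v.2 : ℕ) + 1 = ℓ v.1 then mid v.1 v.2 else 0)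
        (fun _ => 0) := by
  classical
  set z : (Σ d : ι, Fin (ℓ d)) ⊕ Fin pad → S := Sum.elim (fun v : (Σ d : ι, Fin (ℓ d)) =>
    (-1 : S) ^ (ℓ v.1 - 1 - (v.2 : ℕ)) *
      ∏ t ∈ Finset.univ.filter (fun t : Fin (ℓ v.1) => (v.2 : ℕ) ≤ t), mid v.1 t) (fun _ => 0) with hz
  have hz_inl : ∀ (d : ι) (i : Fin (ℓ d)), z (Sum.inl ⟨d, i⟩) = (-1 : S) ^ (ℓ d - 1 - (i : ℕ)) *
      ∏ t ∈ Finset.univ.filter (fun t : Fin (ℓ d) => (i : ℕ) ≤ t), mid d t := fun d i => rfl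
  have hz_inr : ∀ p : Fin pad, z (Sum.inr p) = 0 := fun p => rfl
  funext v
  rw [Matrix.mulVec, dotProduct]
  rcases v with ⟨d, i⟩ | p
  · -- a petal vertex
    rw [Fintype.sum_sum_type]
    have h2 : ∑ p : Fin pad, D (Sum.inl ⟨d, i⟩) (Sum.inr p) * z (Sum.inr p) = 0 :=
      Finset.sum_eq_zero fun p _ => by rw [h_pq, zero_mul]
    rw [h2, add_zero, Fintype.sum_sigma]
    rw [Finset.sum_eq_single d]
    · -- the petal `d` itself
      simp only [h_pp, true_and]
      by_cases hlast : (i : ℕ) + 1 = ℓ d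
      · -- last internal vertex: only the diagonal term survives
        rw [Finset.sum_eq_single i]
        · simp only [if_true, one_mul, Sum.elim_inl, hlast, hz_inl]
          have hfil : Finset.univ.filter (fun t : Fin (ℓ d) => (i : ℕ) ≤ t) = {i} := by
            ext t
            simp only [Finset.mem_filter, Finset.mem_univ, true_and, Finset.mem_singleton]
            constructor
            · intro h; exact Fin.ext (by omega)
            · intro h; rw [h]
          rw [hfil, Finset.prod_singleton]
          have : ℓ d - 1 - (i : ℕ) = 0 := by omega
          rw [this, pow_zero, one_mul]
        · intro i' _ hne
          have h1 : ¬ ((i' : ℕ) = i) := fun h => hne (Fin.ext h)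
          have h2 : ¬ ((i' : ℕ) = i + 1) := fun h => by omega
          rw [if_neg h1, if_neg h2, zero_mul]
        · intro h; exact absurd (Finset.mem_univ i) h
      · -- an inner vertex: diagonal term plus successor term cancel
        have hlt : (i : ℕ) + 1 < ℓ d := by omega
        set i₁ : Fin (ℓ d) := ⟨(i : ℕ) + 1, hlt⟩ with hi₁
        have hne : i₁ ≠ i := fun h => by
          have := congrArg Fin.val h; simp [hi₁] at this
        rw [← Finset.add_sum_erase Finset.univ _ (Finset.mem_univ i),
          ← Finset.add_sum_erase (Finset.univ.erase i) _ (Finset.mem_erase.mpr ⟨hne, Finset.mem_univ i₁⟩)]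
        have hrest : ∑ x ∈ (Finset.univ.erase i).erase i₁,
            (if (x : ℕ) = (i : ℕ) then (1 : S) else if (x : ℕ) = (i : ℕ) + 1 then mid d i else 0) *
              z (Sum.inl ⟨d, x⟩) = 0 := by
          refine Finset.sum_eq_zero fun x hx => ?_
          rw [Finset.mem_erase, Finset.mem_erase] at hx
          have h1 : ¬ ((x : ℕ) = i) := fun h => hx.2.1 (Fin.ext h)
          have h2 : ¬ ((x : ℕ) = i + 1) := fun h => hx.1 (Fin.ext (by rw [hi₁]; exact h))
          rw [if_neg h1, if_neg h2, zero_mul]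
        rw [hrest, add_zero]
        simp only [if_true, one_mul, Sum.elim_inl, hlast, if_false]
        have hi₁v : ((i₁ : ℕ) = (i : ℕ)) = False := by
          rw [hi₁]; simp
        simp only [hi₁v, if_false, hz_inl]
        rw [if_pos (show ((i₁ : ℕ) = (i : ℕ) + 1) from by rw [hi₁])]
        rw [bq_prod_filter_le_succ (mid d) i]
        have hexp : ℓ d - 1 - (i : ℕ) = (ℓ d - 1 - (i₁ : ℕ)) + 1 := by
          rw [hi₁]; simp only; omega
        rw [hexp, pow_succ]
        have hfil : Finset.univ.filter (fun t : Fin (ℓ d) => (i : ℕ) + 1 ≤ t) =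
            Finset.univ.filter (fun t : Fin (ℓ d) => (i₁ : ℕ) ≤ t) := by
          rw [hi₁]
        rw [hfil]
        ring
    · intro d' _ hd'
      refine Finset.sum_eq_zero fun i' _ => ?_
      rw [h_pp]
      have h1 : ¬ (d = d' ∧ (i' : ℕ) = i) := fun h => hd' h.1.symm
      have h2 : ¬ (d = d' ∧ (i' : ℕ) = i + 1) := fun h => hd' h.1.symm
      rw [if_neg h1, if_neg h2, zero_mul]
    · intro h; exact absurd (Finset.mem_univ d) h
  · -- a padding vertex
    simp only [Sum.elim_inr]
    refine Finset.sum_eq_zero fun w _ => ?_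
    rcases w with ⟨d', i'⟩ | p'
    · rw [h_qp, zero_mul]
    · rw [hz_inr, mul_zero]

/-- **The bouquet determinant.**  Let `M` be the matrix of a bouquet with petals `d : ι` (`ℓ d`
internal vertices each, edge labels `first d` out of the hub and `mid d i` out of the internal vertex
`⟨d, i⟩`, the last one returning to the hub; loops `first d` at the hub for `ℓ d = 0`), `pad` isolated
padding vertices, and `1` on the diagonal.  Then
`det M = 1 + ∑ d, (-1)^(ℓ d) * (first d * ∏ i, mid d i)`: no cross terms between petals.  (The hub-row
entries at the padding columns are irrelevant and not constrained.)
[folklore (Harary 1962); proof: Schur complement of the unitriangular internal block] -/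
theorem bq_det_eq (ℓ : ι → ℕ) (pad : ℕ) (first : ι → S) (mid : (d : ι) → Fin (ℓ d) → S)
    (M : Matrix (((Σ d : ι, Fin (ℓ d)) ⊕ Fin pad) ⊕ Unit) (((Σ d : ι, Fin (ℓ d)) ⊕ Fin pad) ⊕ Unit) S)
    (h_pp : ∀ (d : ι) (i : Fin (ℓ d)) (d' : ι) (i' : Fin (ℓ d')),
      M (Sum.inl (Sum.inl ⟨d, i⟩)) (Sum.inl (Sum.inl ⟨d', i'⟩)) =
        if d = d' ∧ (i' : ℕ) = i then 1 else if d = d' ∧ (i' : ℕ) = i + 1 then mid d i else 0)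
    (h_pq : ∀ (d : ι) (i : Fin (ℓ d)) (p : Fin pad), M (Sum.inl (Sum.inl ⟨d, i⟩)) (Sum.inl (Sum.inr p)) = 0)
    (h_qp : ∀ (p : Fin pad) (d : ι) (i : Fin (ℓ d)), M (Sum.inl (Sum.inr p)) (Sum.inl (Sum.inl ⟨d, i⟩)) = 0)
    (h_qq : ∀ p p' : Fin pad, M (Sum.inl (Sum.inr p)) (Sum.inl (Sum.inr p')) = if p = p' then 1 else 0)
    (h_ph : ∀ (d : ι) (i : Fin (ℓ d)),
      M (Sum.inl (Sum.inl ⟨d, i⟩)) (Sum.inr ()) = if (i : ℕ) + 1 = ℓ d then mid d i else 0)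
    (h_qh : ∀ p : Fin pad, M (Sum.inl (Sum.inr p)) (Sum.inr ()) = 0)
    (h_hp : ∀ (d : ι) (i : Fin (ℓ d)),
      M (Sum.inr ()) (Sum.inl (Sum.inl ⟨d, i⟩)) = if (i : ℕ) = 0 then first d else 0)
    (h_hh : M (Sum.inr ()) (Sum.inr ()) = 1 + ∑ d ∈ Finset.univ.filter (fun d => ℓ d = 0), first d) :
    M.det = 1 + ∑ d, (-1 : S) ^ (ℓ d) * (first d * ∏ i : Fin (ℓ d), mid d i) := by
  classical
  -- the blocks
  set D : Matrix ((Σ d : ι, Fin (ℓ d)) ⊕ Fin pad) ((Σ d : ι, Fin (ℓ d)) ⊕ Fin pad) S :=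
    M.toBlocks₁₁ with hD
  set bvec : (Σ d : ι, Fin (ℓ d)) ⊕ Fin pad → S := fun v => M (Sum.inl v) (Sum.inr ()) with hbvec
  set cvec : (Σ d : ι, Fin (ℓ d)) ⊕ Fin pad → S := fun v => M (Sum.inr ()) (Sum.inl v) with hcvec
  have hM : M = Matrix.fromBlocks D (Matrix.replicateCol Unit bvec) (Matrix.replicateRow Unit cvec)
      (Matrix.of fun _ _ => M (Sum.inr ()) (Sum.inr ())) := by
    refine Matrix.ext fun x y => ?_
    rcases x with v | u <;> rcases y with w | u' <;> rfl
  -- `D` is unitriangular for the grading by the position inside the petal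
  set gr : (Σ d : ι, Fin (ℓ d)) ⊕ Fin pad → ℕ := Sum.elim (fun v => (v.2 : ℕ)) (fun _ => 0) with hgr
  have hD_pp : ∀ (d : ι) (i : Fin (ℓ d)) (d' : ι) (i' : Fin (ℓ d')), D (Sum.inl ⟨d, i⟩) (Sum.inl ⟨d', i'⟩) =
      if d = d' ∧ (i' : ℕ) = i then 1 else if d = d' ∧ (i' : ℕ) = i + 1 then mid d i else 0 :=
    fun d i d' i' => h_pp d i d' i'
  have hD_pq : ∀ (d : ι) (i : Fin (ℓ d)) (p : Fin pad), D (Sum.inl ⟨d, i⟩) (Sum.inr p) = 0 :=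
    fun d i p => h_pq d i p
  have hD_qp : ∀ (p : Fin pad) (d : ι) (i : Fin (ℓ d)), D (Sum.inr p) (Sum.inl ⟨d, i⟩) = 0 :=
    fun p d i => h_qp p d i
  have hD_qq : ∀ p p' : Fin pad, D (Sum.inr p) (Sum.inr p') = if p = p' then 1 else 0 :=
    fun p p' => h_qq p p'
  have hsig : ∀ (d : ι) (i : Fin (ℓ d)) (d' : ι) (i' : Fin (ℓ d')),
      (Sum.inl ⟨d, i⟩ : (Σ d : ι, Fin (ℓ d)) ⊕ Fin pad) = Sum.inl ⟨d', i'⟩ ↔ d = d' ∧ (i' : ℕ) = i := by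
    intro d i d' i'
    rw [Sum.inl.injEq]
    constructor
    · rintro ⟨⟩; exact ⟨rfl, rfl⟩
    · rintro ⟨rfl, h⟩
      have : i' = i := Fin.ext h
      subst this; rfl
  have hdiag : ∀ v w : (Σ d : ι, Fin (ℓ d)) ⊕ Fin pad, gr v = gr w → D v w = if v = w then 1 else 0 := by
    intro v w hvw
    rcases v with ⟨d, i⟩ | p <;> rcases w with ⟨d', i'⟩ | p'
    · rw [hD_pp]
      simp only [hgr, Sum.elim_inl] at hvw
      by_cases h : d = d' ∧ (i' : ℕ) = i
      · rw [if_pos h, if_pos ((hsig d i d' i').mpr h)]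
      · rw [if_neg h, if_neg (fun h' => h ((hsig d i d' i').mp h')), if_neg]
        rintro ⟨-, h2⟩; omega
    · rw [hD_pq, if_neg (by simp)]
    · rw [hD_qp, if_neg (by simp)]
    · rw [hD_qq]
      by_cases h : p = p'
      · subst h; simp
      · rw [if_neg h, if_neg (fun h' => h (Sum.inr_injective h'))]
  have hBT : D.BlockTriangular gr := by
    intro v w hvw
    rcases v with ⟨d, i⟩ | p <;> rcases w with ⟨d', i'⟩ | p'
    · rw [hD_pp]
      simp only [hgr, Sum.elim_inl] at hvw
      rw [if_neg, if_neg] <;> rintro ⟨-, h⟩ <;> omega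
    · exact hD_pq d i p'
    · exact hD_qp p d' i'
    · simp only [hgr, Sum.elim_inr, lt_self_iff_false] at hvw
  have hdetD : D.det = 1 := by
    rw [hBT.det]
    refine Finset.prod_eq_one fun a _ => ?_
    have hblk : D.toSquareBlock gr a = 1 := by
      ext ⟨v, hv⟩ ⟨w, hw⟩
      change D v w = (1 : Matrix {x // gr x = a} {x // gr x = a} S) ⟨v, hv⟩ ⟨w, hw⟩
      rw [Matrix.one_apply, hdiag v w (hv.trans hw.symm)]
      by_cases h : v = w
      · subst h; simp
      · rw [if_neg h, if_neg (fun h' => h (congrArg Subtype.val h'))]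
    rw [hblk, Matrix.det_one]
  -- the back-substitution vector
  set z : (Σ d : ι, Fin (ℓ d)) ⊕ Fin pad → S := Sum.elim (fun v : (Σ d : ι, Fin (ℓ d)) =>
    (-1 : S) ^ (ℓ v.1 - 1 - (v.2 : ℕ)) *
      ∏ t ∈ Finset.univ.filter (fun t : Fin (ℓ v.1) => (v.2 : ℕ) ≤ t), mid v.1 t) (fun _ => 0) with hz
  have hDz : D *ᵥ z = bvec := by
    rw [hz, bq_mulVec_z ℓ pad mid D hD_pp hD_pq hD_qp]
    funext v
    rcases v with ⟨d, i⟩ | p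
    · simp only [Sum.elim_inl, hbvec, h_ph]
    · simp only [Sum.elim_inr, hbvec, h_qh]
  -- invertibility of `D` and the Schur complement
  letI : Invertible D.det := Invertible.copy invertibleOne D.det hdetD
  letI : Invertible D := Matrix.invertibleOfDetInvertible D
  have hinvz : ⅟D *ᵥ bvec = z := by
    rw [← hDz, Matrix.mulVec_mulVec, invOf_mul_self, Matrix.one_mulVec]
  rw [hM, Matrix.det_fromBlocks₁₁, hdetD, one_mul, Matrix.det_unique]
  rw [Matrix.sub_apply, Matrix.of_apply, Matrix.mul_assoc, ← Matrix.replicateCol_mulVec, hinvz,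
    Matrix.replicateRow_mul_replicateCol_apply, h_hh]
  -- the hub row against `z`
  have hcz : cvec ⬝ᵥ z = ∑ d, if h : 0 < ℓ d then
      first d * ((-1 : S) ^ (ℓ d - 1) * ∏ t : Fin (ℓ d), mid d t) else 0 := by
    rw [dotProduct, Fintype.sum_sum_type]
    have h2 : ∑ p : Fin pad, cvec (Sum.inr p) * z (Sum.inr p) = 0 :=
      Finset.sum_eq_zero fun p _ => by simp [hz]
    rw [h2, add_zero, Fintype.sum_sigma]
    refine Finset.sum_congr rfl fun d _ => ?_
    by_cases hd : 0 < ℓ d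
    · rw [dif_pos hd, Finset.sum_eq_single (⟨0, hd⟩ : Fin (ℓ d))]
      · simp only [hcvec, h_hp, if_true, hz, Sum.elim_inl, Nat.sub_zero]
        congr 2
        refine Finset.prod_congr ?_ fun _ _ => rfl
        ext t; simp
      · intro i _ hi
        have : ¬ ((i : ℕ) = 0) := fun h => hi (Fin.ext h)
        simp only [hcvec, h_hp, this, if_false, zero_mul]
      · intro h; exact absurd (Finset.mem_univ _) h
    · rw [dif_neg hd]
      have h0 : ℓ d = 0 := by omega
      refine Finset.sum_eq_zero fun i _ => ?_
      exact absurd i.2 (by omega)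
  rw [hcz]
  -- bookkeeping of the two kinds of petals
  rw [Finset.sum_filter, add_sub_assoc, ← Finset.sum_sub_distrib]
  congr 1
  refine Finset.sum_congr rfl fun d _ => ?_
  by_cases hd : 0 < ℓ d
  · have h0 : ¬ (ℓ d = 0) := by omega
    rw [if_neg h0, dif_pos hd, zero_sub]
    have hexp : (-1 : S) ^ (ℓ d) = (-1 : S) ^ (ℓ d - 1) * (-1) := by
      rw [← pow_succ]
      congr 1
      omega
    rw [hexp]
    ring
  · have h0 : ℓ d = 0 := by omega
    rw [if_pos h0, dif_neg hd, sub_zero]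
    have hprod : ∏ i : Fin (ℓ d), mid d i = 1 := by
      have : IsEmpty (Fin (ℓ d)) := by rw [h0]; infer_instance
      exact Finset.prod_of_isEmpty _
    rw [hprod, h0, pow_zero, one_mul, mul_one]

end

end Summit.ValiantsHypothesis.ValiantsHypothesis.Theorems.ValuativeFlip
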